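import Summits.BirchSwinnertonDyer.BirchSwinnertonDyer.Theorems.SchneiderFreeAdditiveX3KYReadHyps
import HarnessLib
import HarnessLib.Audit.Tags

/-!
# Route `SchneiderFreeAdditiveX3` (K1 door), SECOND WING on the (G-ord, `e = 2`) cell — NAMED HYPOTHESES of
# the KY-read CO-SOCKET record (Theses-free short names for a sibling-route H-record)

Cell `bsd-schneider-ideate`, seat `bsd-schneider-door-c5` (prover, generation 9); sibling of door-c3 gen 8's
`…KYReadHyps.lean` (`KYRead.KYReadCH` / `KYReadSliver`, the LOWER record's inputs). The second wing's
(G-ord, `e = 2`) co-socket `Upper.AdditiveIMCUpperBDPInputManinAt W p` at KY-normalised curves is proved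
(`…UpperCoSocketOfKY.lean`, `Upper.additiveIMCUpperBDPInputManinAt_of_facts_of_KY_OPEN_of_CHUnit`, p491532)
from named facts, Keller–Yin Thm. 3.5.1 (typed PREPRINT claim, its `⊆ Char` half, `μ`-free) and TWO long
hypotheses, named here VERBATIM:

* `KYReadCHUnit` — `KYRead.KYReadCH` (CH18 §3 frame at the conjugate prime `𝔭′` + the conductor-`p` VALUE
  FORMULA at the descended genus-twisted Heegner point) with the value cofactor a UNIT `u ∈ R₀ˣ` and WITHOUT
  the clause `¬ p ∣ L` (the upper direction reads `(L) ⊆ Char`, insensitive to `μ(L)`, but needs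
  `ord_p u = 0` — the ONE strengthened reading of print the wing adds; door-c3 gen 8's branch-currency memo:
  `ε(½,χ_{ε,𝔭})² = ±1`).
* `KYReadSliverUpper` — the bundled upper input on the sockets with `d_K = −3` (outside Keller–Yin's
  Assumption 2.0.3; void at `p = 3`, census-void on the door's 7 101 pairs, door-c5 gen 8): `∃ L (u ∈ R₀ˣ)`,
  `(L) ⊆ Char·R₀⟦T⟧` ∧ the unit value formula with the logarithm at `𝔭`.

With these names the sibling route's r3 record reads `PrintedFacts → ControlFacts → RebasedFactsG →
thm351_…_OPEN → KYReadCHUnit → KYReadSliverUpper → ‹hCoG›` (closer in `…UpperWingGordOfKYRead.lean`).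
HONEST FRAMING: predicates, nothing asserted, tagged `@[conjecture]` like the route's sockets; hypotheses of
the road, not facts of the tree; BSD is not advanced. Theses-free (imports only Theorems defs / Literature).

References: Keller–Yin arXiv:2410.23241 Thm. 3.5.1, Assumption 2.0.3; Castella–Hsieh, Math. Ann. 370 (2018)
§3, Thm. 5.7, Lemma 5.4 (arXiv:1505.08165 pp. 10–11, 17–19); Gross 1991 §3; Darmon 2004 Thm. 3.6.
-/

noncomputable section

open scoped Classical ComplexConjugate

open WeierstrassCurve NumberField IsDedekindDomain Field PowerSeries
  Literature.NumberTheory.EllipticCurves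
  Literature.NumberTheory.EllipticCurves.ModularForms
  Literature.NumberTheory.EllipticCurves.GreenbergSelmer
  Literature.NumberTheory.EllipticCurves.Rank1Residual
  Literature.NumberTheory.EllipticCurves.KellerYin2024
  Literature.NumberTheory.GaloisRepresentations
  Summit.BirchSwinnertonDyer.Rank1Residual
  Summit.BirchSwinnertonDyer.Rank1Residual.X11b
  Summit.BirchSwinnertonDyer.Rank1Residual.X11b.AcSelmer
  Summit.BirchSwinnertonDyer.Rank1Residual.X11b.Halves

set_option linter.dupNamespace false
set_option autoImplicit false

namespace Summit.BirchSwinnertonDyer.BirchSwinnertonDyer.Theorems.SchneiderFree.KYRead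

/-! ## §1 The Castella–Hsieh input of the UPPER record: a unit cofactor, no `μ`-clause -/

/-- **`KYReadCHUnit`** — the Castella–Hsieh input of the second wing's KY-read co-socket record (`hCHu` of
`Upper.additiveIMCUpperBDPInputManinAt_of_facts_of_KY_OPEN_of_CHUnit`, VERBATIM). For the presented door
curve `W = C₂ • ((D • W′) ⊗ χ_{p*})` (`W′` good ordinary at `p`) at every socket datum with `d_K ≠ −3`, every
conjugate degree-one prime `𝔭′ ≠ 𝔭` above `p` and every embedding datum `ι′` inducing `𝔭′`: CM periods
`Ω_K ≠ 0`, `Ω_p ≠ 0`, a frame `L ∈ R₀⟦T⟧` with `IsBDPLFunction ι′ 𝔭′ κ γ Dt.f Ω_K Ω_p L` (the branch AT `𝔭′`),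
and the conductor-`p` VALUE FORMULA `L(𝟙) = u·(log_{ω_W}(Q)/c′)²` with a UNIT `u ∈ R₀ˣ` at the descent `Q ∈ W(K)`
of the genus-twisted conductor-`p` Heegner point of `W′` over `K[p]`, the logarithm through `embAt K p 𝔭′`.
Compared with `KYReadCH`: NO clause `¬ p ∣ L` (the upper direction reads Keller–Yin's `(L) ⊆ Char`, true
whatever `μ(L)` is), and the cofactor must be a UNIT (the one strengthened reading). In print: Castella–Hsieh's
construction and `p`-adic Gross–Zagier formula for `(f̃ = f_{W′}, χ_ε)` read as a frame of `f = f̃ ⊗ ε`, the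
explicit constants at a conductor-`p` genus character being `p`-units (to be page-checked by the typer lane).
A predicate; nothing asserted; UNTYPED input. [cite: CastellaHsieh2018, §3 Def. 3.7 / Prop. 3.8, Thm. 5.7 and Lemma 5.4 (arXiv:1505.08165 pp. 10–11, 17–19)]
[cite: KellerYin2024b, §3.4 and Thm. 3.5.1 (arXiv:2410.23241 pp. 19–20) (preprint)] -/
@[conjecture]
def KYReadCHUnit : Prop :=
  ∀ (p : ℕ) [Fact p.Prime] (W' : WeierstrassCurve ℚ) [W'.IsElliptic] [W'.IsGloballyMinimal]
    [NeZero (W'.conductorNorm ℤ)] (D C₂ : VariableChange ℚ) [(D • W').IsCharNeTwoNF]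
    [(C₂ • (D • W').quadraticTwist ((-1 : ℚ) ^ (p / 2) * p)).IsElliptic]
    [(C₂ • (D • W').quadraticTwist ((-1 : ℚ) ^ (p / 2) * p)).IsGloballyMinimal]
    (N : ℕ) [NeZero N] (K : Type) [Field K] [NumberField K]
    (Dt : ModularParametrizationData (C₂ • (D • W').quadraticTwist ((-1 : ℚ) ^ (p / 2) * p)) N)
    (H : HeegnerDatum N (NumberField.discr K)) (ι : K →+* ℂ)
    (P : ((C₂ • (D • W').quadraticTwist ((-1 : ℚ) ^ (p / 2) * p)).baseChange K).toAffine.Point),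
    (C₂ • (D • W').quadraticTwist ((-1 : ℚ) ^ (p / 2) * p)).analyticRank = 1 →
    Additive.N10.Locus (C₂ • (D • W').quadraticTwist ((-1 : ℚ) ^ (p / 2) * p)) p →
    (C₂ • (D • W').quadraticTwist ((-1 : ℚ) ^ (p / 2) * p)).conductorNorm ℤ = N →
    IsImaginaryQuadratic K → Odd (NumberField.discr K) → ¬ p ∣ Units.torsionOrder K →
    SatisfiesHeegnerHypothesis N K →
    ((C₂ • (D • W').quadraticTwist ((-1 : ℚ) ^ (p / 2) * p)).quadraticTwist
      (NumberField.discr K : ℚ)).entireLFunction 1 ≠ 0 →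
    WeierstrassCurve.Affine.Point.map ι.toRatAlgHom P = heegnerPointComplex Dt H →
    ¬ IsOfFinAddOrder P → p ≠ 2 → GoodOrd W' p → NumberField.discr K ≠ -3 →
    ∀ (κ : ZpExtension K p), κ.IsAnticyclotomic →
    ∀ (γ : Field.absoluteGaloisGroup K) [Fact (κ.IsTopGenerator γ)]
      (𝔭 : HeightOneSpectrum (𝓞 K)) (h𝔭 : ((p : ℕ) : 𝓞 K) ∈ 𝔭.asIdeal)
      (he : 𝔭.asIdeal.ramificationIdx (𝓞 ℚ) = 1) (hf : 𝔭.asIdeal.inertiaDeg (𝓞 ℚ) = 1),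
    ∀ [NumberField (ringClassField K ι p)]
      (Dt' : ModularParametrizationData W' (W'.conductorNorm ℤ)),
    ∀ (𝔭' : HeightOneSpectrum (𝓞 K)) (h𝔭' : ((p : ℕ) : 𝓞 K) ∈ 𝔭'.asIdeal)
      (he' : 𝔭'.asIdeal.ramificationIdx (𝓞 ℚ) = 1) (hf' : 𝔭'.asIdeal.inertiaDeg (𝓞 ℚ) = 1),
    𝔭 ≠ 𝔭' → ∀ (ι' : PadicAlgCl p ≃+* ℂ), BranchInducesPrime p ι' 𝔭' →
    ∃ (ΩK : ℂ) (Ωp : ℂ_[p]) (L : UnrSeries p) (u : (unrIntegers p)ˣ),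
      ΩK ≠ 0 ∧ Ωp ≠ 0 ∧ IsBDPLFunction ι' 𝔭' κ γ Dt.f ΩK Ωp L ∧
      ∀ (y : (W'.baseChange (ringClassField K ι p : Type)).toAffine.Point),
        WeierstrassCurve.Affine.Point.map (ringClassField K ι p).subtype.toRatAlgHom y =
          heegnerPointComplexOfConductor Dt' (NumberField.discr K) H.β p →
        ∀ (θ : ringClassField K ι p)
          (hθ2 : θ ^ 2 = algebraMap ℚ (ringClassField K ι p) ((-1 : ℚ) ^ (p / 2) * p))
          (hθ : θ ≠ 0) (s : ringClassGal ι p → ℤˣ),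
        (∀ σ : ringClassGal ι p, σ.1 θ = ((s σ : ℤ) : ringClassField K ι p) * θ) →
        ∀ Q : ((C₂ • (D • W').quadraticTwist ((-1 : ℚ) ^ (p / 2) * p)).baseChange K).toAffine.Point,
        Affine.Point.map (algebraMap K (ringClassField K ι p)).toRatAlgHom Q =
          VariableChange.pointEquivBaseChange ((D • W').quadraticTwist ((-1 : ℚ) ^ (p / 2) * p)) C₂
            (ringClassField K ι p)
            ((VariableChange.pointEquiv (((D • W').quadraticTwist
                ((-1 : ℚ) ^ (p / 2) * p)).baseChange (ringClassField K ι p : Type))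
                (untwistAt hθ)).symm
              ((Affine.Point.congrEquiv (untwistAt_smul_eq (D • W') hθ2 hθ)).symm
                (VariableChange.pointEquivBaseChange W' D (ringClassField K ι p)
                  (∑ τ : ringClassGal ι p,
                    (s τ : ℤ) • pointGalHom W' (ringClassField K ι p : Type) τ.1 y)))) →
        L.HasValueAt 0 ((((u : unrIntegers p)) : ℂ_[p]) *
          (algebraMap ℚ_[p] ℂ_[p] (logOmega (C₂ • (D • W').quadraticTwist ((-1 : ℚ) ^ (p / 2) * p))
            p (embAt K p 𝔭' h𝔭' he' hf') Q / (Dt'.c : ℚ_[p]))) ^ 2)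

/-! ## §2 The `d_K = −3` sliver of the UPPER record -/

/-- **`KYReadSliverUpper`** — the bundled upper frame input (`(L) ⊆ Char·R₀⟦T⟧` ∧ the unit value formula,
logarithm at `𝔭` itself) RESTRICTED to the sockets with `d_K = −3` (`hSliverU` of
`Upper.additiveIMCUpperBDPInputManinAt_of_facts_of_KY_OPEN_of_CHUnit`, VERBATIM): outside Keller–Yin's standing
Assumption 2.0.3 ("`D_K < −3`"); void at `p = 3` (`p ∤ #𝓞_K^× = 6`); census-void on the door (door-c5 gen 8:
none of the 7 101 pairs admits `ℚ(√−3)` as a Heegner field); the co-socket as typed quantifies over every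
Heegner field, so it remains an input of the record. A predicate; nothing asserted.
[cite: KellerYin2024b, Assumption 2.0.3 (arXiv:2410.23241 p. 8)] [cite: CastellaHsieh2018, Thm. 5.7] -/
@[conjecture]
def KYReadSliverUpper : Prop :=
  ∀ (p : ℕ) [Fact p.Prime] (W' : WeierstrassCurve ℚ) [W'.IsElliptic] [W'.IsGloballyMinimal]
    [NeZero (W'.conductorNorm ℤ)] (D C₂ : VariableChange ℚ) [(D • W').IsCharNeTwoNF]
    [(C₂ • (D • W').quadraticTwist ((-1 : ℚ) ^ (p / 2) * p)).IsElliptic]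
    [(C₂ • (D • W').quadraticTwist ((-1 : ℚ) ^ (p / 2) * p)).IsGloballyMinimal]
    (N : ℕ) [NeZero N] (K : Type) [Field K] [NumberField K]
    (Dt : ModularParametrizationData (C₂ • (D • W').quadraticTwist ((-1 : ℚ) ^ (p / 2) * p)) N)
    (H : HeegnerDatum N (NumberField.discr K)) (ι : K →+* ℂ)
    (P : ((C₂ • (D • W').quadraticTwist ((-1 : ℚ) ^ (p / 2) * p)).baseChange K).toAffine.Point),
    (C₂ • (D • W').quadraticTwist ((-1 : ℚ) ^ (p / 2) * p)).analyticRank = 1 →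
    Additive.N10.Locus (C₂ • (D • W').quadraticTwist ((-1 : ℚ) ^ (p / 2) * p)) p →
    (C₂ • (D • W').quadraticTwist ((-1 : ℚ) ^ (p / 2) * p)).conductorNorm ℤ = N →
    IsImaginaryQuadratic K → Odd (NumberField.discr K) → ¬ p ∣ Units.torsionOrder K →
    SatisfiesHeegnerHypothesis N K →
    ((C₂ • (D • W').quadraticTwist ((-1 : ℚ) ^ (p / 2) * p)).quadraticTwist
      (NumberField.discr K : ℚ)).entireLFunction 1 ≠ 0 →
    WeierstrassCurve.Affine.Point.map ι.toRatAlgHom P = heegnerPointComplex Dt H →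
    ¬ IsOfFinAddOrder P → p ≠ 2 → GoodOrd W' p → NumberField.discr K = -3 →
    ∀ (κ : ZpExtension K p), κ.IsAnticyclotomic →
    ∀ (γ : Field.absoluteGaloisGroup K) [Fact (κ.IsTopGenerator γ)]
      (𝔭 : HeightOneSpectrum (𝓞 K)) (h𝔭 : ((p : ℕ) : 𝓞 K) ∈ 𝔭.asIdeal)
      (he : 𝔭.asIdeal.ramificationIdx (𝓞 ℚ) = 1) (hf : 𝔭.asIdeal.inertiaDeg (𝓞 ℚ) = 1),
    ∀ [NumberField (ringClassField K ι p)]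
      (Dt' : ModularParametrizationData W' (W'.conductorNorm ℤ)),
    ∃ (L : UnrSeries p) (u : (unrIntegers p)ˣ),
      Ideal.span {L} ≤ (XAc.charIdeal ((C₂ • (D • W').quadraticTwist ((-1 : ℚ) ^ (p / 2) * p)).baseChange K)
          p κ 𝔭 ∅ γ).map (PowerSeries.map (toUnr p)) ∧
      ∀ (y : (W'.baseChange (ringClassField K ι p : Type)).toAffine.Point),
        WeierstrassCurve.Affine.Point.map (ringClassField K ι p).subtype.toRatAlgHom y =
          heegnerPointComplexOfConductor Dt' (NumberField.discr K) H.β p →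
        ∀ (θ : ringClassField K ι p)
          (hθ2 : θ ^ 2 = algebraMap ℚ (ringClassField K ι p) ((-1 : ℚ) ^ (p / 2) * p))
          (hθ : θ ≠ 0) (s : ringClassGal ι p → ℤˣ),
        (∀ σ : ringClassGal ι p, σ.1 θ = ((s σ : ℤ) : ringClassField K ι p) * θ) →
        ∀ Q : ((C₂ • (D • W').quadraticTwist ((-1 : ℚ) ^ (p / 2) * p)).baseChange K).toAffine.Point,
        Affine.Point.map (algebraMap K (ringClassField K ι p)).toRatAlgHom Q =
          VariableChange.pointEquivBaseChange ((D • W').quadraticTwist ((-1 : ℚ) ^ (p / 2) * p)) C₂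
            (ringClassField K ι p)
            ((VariableChange.pointEquiv (((D • W').quadraticTwist
                ((-1 : ℚ) ^ (p / 2) * p)).baseChange (ringClassField K ι p : Type))
                (untwistAt hθ)).symm
              ((Affine.Point.congrEquiv (untwistAt_smul_eq (D • W') hθ2 hθ)).symm
                (VariableChange.pointEquivBaseChange W' D (ringClassField K ι p)
                  (∑ τ : ringClassGal ι p,
                    (s τ : ℤ) • pointGalHom W' (ringClassField K ι p : Type) τ.1 y)))) →
        L.HasValueAt 0 ((((u : unrIntegers p)) : ℂ_[p]) *
          (algebraMap ℚ_[p] ℂ_[p] (logOmega (C₂ • (D • W').quadraticTwist ((-1 : ℚ) ^ (p / 2) * p))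
            p (embAt K p 𝔭 h𝔭 he hf) Q / (Dt'.c : ℚ_[p]))) ^ 2)

end Summit.BirchSwinnertonDyer.BirchSwinnertonDyer.Theorems.SchneiderFree.KYRead

end
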